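import Summits.QuantumFields.YangMills.Theorems.BalabanUVNodesN16Thm1AtTorusVPSmallCubesPrep
import Summits.QuantumFields.YangMills.Theorems.BalabanUVNodesN16H7TightWindow
import Summits.QuantumFields.BalabanUV.T4Continuum.Support.MinimalActionFromThm1KDatum
import Literature.MathematicalPhysics.QuantumFieldTheory.Balaban1983to89.Node00.RateRecord11NE3Data
import HarnessLib

/-!
# Route «BalabanUVNodes», crux K3⁷ `SpineGivenEndpointR13SepCoPH` (stmt-QuantumFields-20544) — node N16 = NE3, in-edge N07 → N16:
# THE DISPLAYED N07 IN-EDGE `stub_thm1At` OF THE (β16) LOOSE ROAD IS FALSE AS TYPED — leaf-06's torus reading of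
# [Balaban1985Variational] Theorem 1 (`MinimalActionDictionary.torusVP`, divergence D-s3-3: regularity (9)–(10) on ALL lattice cubes
# with the M-PROPORTIONAL factor) forces deep-level minimisers flat, and [Balaban1985Averaging] Prop. 2 then contradicts a constant
# `SU(2)` datum with one plaquette at distance exactly `ε₁` from `1`

Cell `pub-ymgap`, seat `pub-ymgap-dag-n16-w2` (WIDTH SEAT 2∕3 on node N16; director-ym №197 ∕ HUMAN RULING D-0149), generation g4.
`--kind proof --supports stmt-QuantumFields-20544 --as helper` (count-neutral).  `bears_on: R4∕N16 · in-edge N07 → N16`.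
THEOREMS ONLY (0 `def`, 0 `sorry`, standard axioms); file 2 of 2 (file 1 = `…N16Thm1AtTorusVPSmallCubesPrep`: plaquettes from local gauges §1,
the constant `SU(2)` datum §2).

## What is refuted, exactly

Every producer of K3⁷ v5's N16 conjuncts on the (β16) LOOSE road of record — `N16H7OfReg9.leafH3sup_loose_of_thm1At_torusVP`
(p584527), `N16H7LooseOfThm1At.*` (p597330 ∕ p599040 ∕ p602214), `N16InteriorOfCapture` §2–§4 (p606074), `N16PinnedLayer13CoPH` §4
(p600861), `N16PinnedLooseMatch.*` (p604267), `N16LettersOfLettersB9SrcAllTorus.*_thm1At` (p603607), `N16PinnedLooseMatchOfLettersB9Src.*`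
(p605535) — displays node N07's in-edge as FOUR binders: a local-gauge shape `G` monotone in its radii (`hGm : RadiiMono d G`), its
(9)_{β₀=1} interface (`hG`: on a cube `box K x`, `K ≥ 2`, `G U x K α₀ α₁ α₂` supplies a unitary gauge `u` and a potential `a` with
`U^u = exp a`, `‖a‖ ≤ α₀` within `|·|₁ ≤ 2` of `x`, `‖∇a‖ ≤ α₁` within `1`, `‖∇∇a(x)‖ ≤ α₂`), constants `C : B11Thm1.Consts` with
`M(e) ≥ 7∕2` (`hM`), and `hT : ∀ k, B11Thm1.Thm1At C (MinimalActionDictionary.torusVP d L N G (k+1))`.  The N16 discharge tests v3 ∕ v5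
(evidence 9292a7456083a101 ∕ 12c798370dcce7fe on stmt-QuantumFields-20544) call the conjunction `stub_thm1At F`.

**Theorem `not_forall_thm1At_torusVP` (§1):** for the gauge group of rank two (`Matrix (Fin 2) (Fin 2) ℂ`), ANY dimension with two
directions `i₀ ≠ i₁`, ANY `L ≥ 2`, ANY torus factor `N`, ANY `C` and ANY radii-monotone `G` with the interface, `¬ ∀ k, Thm1At C (torusVP d L N G (k+1))`.
**Corollary `not_stub_thm1At` (§2):** `stub_thm1At F` is false for every `F : T4Family` at `N = 2` (text negated VERBATIM); hence the
producers listed above are VACUOUS AS TYPED at `N = 2` (chair A6).  `hM` and the second-difference clause of the interface are not used.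
**Corollary `not_forall_thm1At_torusVP_expGauge` (§3):** the same for row NE3-R2's shape `AveragingDeficitKDatum.ExpGauge` — the `hThm`
binder of leaf-06's END `MinimalActionFromThm1KDatum.upperData_of_thm1At_expGauge` ∕ `exists_tendsto_minAct_of_thm1At_expGauge` is
uninhabited at rank two (cell `pub-balaban`, NE3 route (A): located for its owners).

## Why (the located reading, first-hand)

Print ([Balaban1985Variational] p. 279 L1–5): the regularity cubes □ are «contained in B_j(Λ_j) ∪ B_{j+1}(Λ_{j+1}) … a union of big
blocks of the L^{−j}-lattice. More exactly we assume that □ has a size 2ML^jη, where M is a multiple of R₁M₁», and (9)–(10) bound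
`|A|, |∇^ηA|, |Δ^ηA|` by `B₃Mε₁(L^jη)^{−1,−2,−3}` — M-PROPORTIONAL with `M ≥ R₁M₁ ≥ 1`.  Leaf-06's instance `torusVP` (declared
divergence D-s3-3, `Support/MinimalActionDictionary` header) takes `Cube := Site d × ℕ`, ALL lattice cubes `box K y`, with
`sizeM (y, K) = cubeM L j K = (2K+1)∕(2L^j)`, and `Reg910` asks `Regularity` for every cube with `sizeM ≤ M(ε₁)` — including `K = 2`,
`M = 5∕(2L^j) ≪ 1`, at the factor `B₃ · 5∕(2L^j) · ε₁`.  By `gauge_of_regularity` and the interface this is, about EVERY site, a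
local exponential gauge with `‖∇a‖ ≤ c∕(L^j)²`, `c = 5B₃ε₁∕(2L^j)` (§1), so (Prep §1 `smallField_of_localGauges`: four exponentials,
`AveragingDeficitFluxExpansion.norm_fhol_sub_one_le`, unitary conjugation) EVERY plaquette of the (8)-minimiser `U` is within
`(2c + 16c²)∕(L^j)²` of `1`; by [Balaban1985Averaging] Prop. 2 (tree: `B7Prop2Explicit.prop2_explicit_lt_two`; §0
`smallField_avgIter_of_mem_sfClass`) its datum `V = avgIter L U j` has every plaquette within `4(2c + 16c²) ≤ 24c < ε₁` of `1`.
But hypothesis (7) only says `V ∈ sfClass d L N ε₁ 0`, and Prep §2 (`exists_constDatum`) exhibits such a datum — the CONSTANT configuration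
with the rotation `R = [[c, −s], [s, c]]` (`s = ε₁∕2`) on the `i₀`-bonds, `P = diag(i, −i)` on the `i₁`-bonds, `1` elsewhere:
unitary, periodic of every period, plaquette holonomies `1`, `R P R⁻¹ P⁻¹` or its inverse, and `‖R P R⁻¹ P⁻¹ − 1‖ = ‖(2s) • M‖ = ε₁`
EXACTLY (`M` unitary, C⋆-norm).  Choosing the level with `L^j > max(5B₃ε₁∕(2c_min), 5∕(2M(ε₁)))` closes the contradiction.

## What this is NOT, and the located repair (planners' ∕ leaf-06's pen — not this file's)

NOT a refutation of [Balaban1985Variational] Theorem 1: print's cubes have `M ≥ R₁M₁`, for which the M-proportional bound is WEAKER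
than the class radius and no contradiction arises.  NOT a statement about K3⁷ v5's registered stubs (`stub_rates13H`, `stub_expansion13H`
are not named).  The witness uses the cube size `M = 5∕(2L^j) < 1`; it MISSES the repaired reading C′ = «(9)–(10) on print's cube class
only» (e.g. a torus instance whose `Cube` carries `L^j ≤ 2K+1`, or `Reg910` restricted to `1 ≤ sizeM c`); N16's consumers use the
single cube `K = L^{k+1} − 1 + L^{k+1} + 2` (`cubeM_slot_le : M ≤ 7∕2`), so their proofs transfer to C′ by name once it is declared.

HONEST FRAMING.  Kernel bookkeeping over landed theorems BY NAME + one explicit `2 × 2` datum; no estimate of Bałaban's is proved or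
refuted; no `def`, no `sorry`; N16 ∕ N07 ∕ N19 NOT discharged; counts UNMOVED (typed 28∕28 · discharged 5∕27 · A 5∕28); one finite
four-torus at fixed ε — R4 closes the conditional finite-𝕋⁴ rung `BalabanLadder.UV` only; the YM mass gap (Clay) is NOT proved by any
of this; nothing continuum ∕ ℝ⁴ ∕ OS.
-/

set_option autoImplicit false

open scoped BigOperators Matrix Matrix.Norms.L2Operator
open NormedSpace

namespace Summit.QuantumFields.YangMills.BalabanUVNodes.N16Thm1AtTorusVPSmallCubes

open Literature.MathematicalPhysics.QuantumFieldTheory.Balaban1983to89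
open B7Prop1Explicit B7Prop2Explicit MatrixLog UnitaryModel
open T4AveragingDeficitWall hiding Site Plane Plaq Bond
open Summit.QuantumFields.BalabanUV.T4Continuum
open MinimalActionRate (sfClass)
open AveragingDeficitLatticeH2Prep (fd)
open Summit.QuantumFields.YangMills.BalabanUVNodes.N16Thm1AtTorusVPSmallCubesPrep (smallField_of_localGauges exists_constDatum)
open Summit.QuantumFields.YangMills.BalabanUVNodes.N16H7TightWindow (pdev_le_of_mem_sfClass)

noncomputable section

variable {d : ℕ}


/-! ## §0 [Balaban1985Averaging] Proposition 2 BY NAME, membership form -/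

section PropTwo

variable {n : Type} [Fintype n] [DecidableEq n] [Nonempty n]

/-- **THE `(k+1)`-FOLD AVERAGE OF A CLASS MEMBER IS `4r`-SMALL** ([Balaban1985Averaging] Prop. 2 (54) BY NAME, uniformly in the level; the
membership form of `N16H7TightWindow.smallField_datum_of_isMinimiser`, whose proof uses only `IsMinimiser.mem`).  `L ≥ 2`, `0 < r`,
`C₀(d)·(2r) ≤ ⅓`, `2·(2r) ≤ c₂′(d,L)`; `U ∈ sfClass d L N r (k+1)` and `avgIter L U (k+1) = V` ⟹ `SmallField V (4r)`
(`pdev U ≤ rη² < 2rη²`, `B7Prop2Explicit.prop2_explicit_lt_two` at `α₀ = 2r`, averages unitary by `prop2_unitaryUnits`, `le_pdev`).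
[cite: Balaban1985Averaging, Prop. 2 (52)–(54) p.26] -/
theorem smallField_avgIter_of_mem_sfClass {L N : ℕ} (hL : 2 ≤ L) {r : ℝ} (hr : 0 < r) (hr3 : C0 d * (2 * r) ≤ 1 / 3)
    (hr2 : 2 * (2 * r) ≤ c2' d L) {k : ℕ} {V U : Site d → Fin d → (Matrix n n ℂ)ˣ} (hU : U ∈ sfClass d L N r (k + 1))
    (havg : avgIter L U (k + 1) = V) : SmallField V (4 * r) := by
  letI : CStarAlgebra (Matrix n n ℂ) := {}
  have hu := hU.1
  have hLk : (0 : ℝ) < ((L : ℝ) ^ (k + 1)) ^ 2 := by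
    have hL0 : (0 : ℝ) < L := by exact_mod_cast (by omega : 0 < L)
    positivity
  have hpdev : pdev U < 2 * r * (((L : ℝ) ^ (k + 1))⁻¹) ^ 2 := by
    have hle := pdev_le_of_mem_sfClass hr.le hU
    rw [inv_pow, ← div_eq_mul_inv]
    exact hle.trans_lt (div_lt_div_of_pos_right (by linarith) hLk)
  have hα : (0 : ℝ) < 2 * r := by linarith
  have h54 := prop2_explicit_lt_two L hL (avgClosed_unitaryUnits d L) (k + 1) U hu hα hr3 hr2 hpdev
  have hunit := (prop2_unitaryUnits L hL (k + 1) U hu hα hr3 hr2 hpdev).2 (k + 1) le_rfl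
  rw [havg] at h54 hunit
  have hV1 : ∀ x κ, V x κ ∈ U1 (Matrix n n ℂ) := fun x κ => unitaryUnits_le_U1 (hunit x κ)
  intro x κ κ' _
  have h := le_pdev hV1 x κ κ'
  linarith

end PropTwo

/-! ## §1 THE REFUTATION: no constants and no honest local-gauge shape make `Thm1At C (torusVP d L N G (k+1))` hold at all levels -/

section Refutation
set_option maxHeartbeats 400000 in
/-- **★ [B11] THEOREM 1 IN LEAF-06's TORUS READING FAILS AT DEEP LEVELS, for every block of constants and every radii-monotone
local-gauge shape with the (9)_{β₀=1} interface** (gauge group `U(2)`∕`SU(2)`, any dimension with two directions `i₀ ≠ i₁`, any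
`L ≥ 2`, any torus factor `N`; only the ZEROTH- and FIRST-order part of the interface is used — potential and first differences
within `|·|₁ ≤ 2` resp. `1` of the centre at cubes `K ≥ 2` — so both the stub's sup shape and row NE3-R2's `ExpGauge` (§3) are covered).  REASON (divergence D-s3-3 of `MinimalActionDictionary.torusVP`): the regularity clause
`Reg910` is read on ALL lattice cubes `box K y`, size parameter `cubeM L j K = (2K+1)∕(2L^j) ≤ M(ε₁)`, with the M-PROPORTIONAL
factor `B₃·M·ε₁` — print's cubes have `M ∈ R₁M₁ℕ` ([Balaban1985Variational] p. 279 L1–5).  At `K = 2` and level `j = k+1`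
with `L^j` large, `gauge_of_regularity` + the interface put about EVERY site a gauge with `‖∇a‖ ≤ c∕(L^j)²`, `c = 5B₃ε₁∕(2L^j)`,
so every plaquette of the (8)-minimiser `U` is within `(2c + 16c²)∕(L^j)²` of `1` (Prep §1); Prop. 2 then makes its datum
`V = avgIter L U j` `4(2c+16c²)`-small (§0) — but the constant datum of Prep §2 lies in the class `sfClass d L N ε₁ 0` (hypothesis
(7)) with one plaquette at distance EXACTLY `ε₁`, and `24c < ε₁`.  So `∀ k, Thm1At C (torusVP d L N G (k+1))` is FALSE: the
`hT` binder of the (β16) loose-road producers is uninhabited as typed.  Print's Theorem 1 (cubes with `M ≥ R₁M₁`) is NOT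
refuted by this. [cite: Balaban1985Variational, Thm 1 (8)–(10) p.279] -/
theorem not_forall_thm1At_torusVP {i₀ i₁ : Fin d} (h01 : i₀ ≠ i₁) {L : ℕ} (hL : 2 ≤ L) (N : ℕ)
    {G : (Site d → Fin d → (Matrix (Fin 2) (Fin 2) ℂ)ˣ) → Site d → ℕ → ℝ → ℝ → ℝ → Prop} (hGm : MinimalActionDictionary.RadiiMono d G)
    (hG : ∀ (U : Site d → Fin d → (Matrix (Fin 2) (Fin 2) ℂ)ˣ) (x : Site d) (K : ℕ) (α₀ α₁ α₂ : ℝ), 2 ≤ K → G U x K α₀ α₁ α₂ →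
      ∃ (u : Site d → (Matrix (Fin 2) (Fin 2) ℂ)ˣ) (a : Site d → Fin d → (Matrix (Fin 2) (Fin 2) ℂ)),
        (∀ z, u z ∈ unitaryUnits (Matrix (Fin 2) (Fin 2) ℂ)) ∧
        (∀ (y : Site d) (τ : Fin d), l1 (y - x) ≤ 2 → ((gaugeAct u U y τ : (Matrix (Fin 2) (Fin 2) ℂ)ˣ) : (Matrix (Fin 2) (Fin 2) ℂ)) = exp (a y τ)) ∧
        (∀ (y : Site d) (τ : Fin d), l1 (y - x) ≤ 2 → ‖a y τ‖ ≤ α₀) ∧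
        (∀ (y : Site d) (τ i : Fin d), l1 (y - x) ≤ 1 → ‖fd i (fun z => a z τ) y‖ ≤ α₁))
    (C : B11Thm1.Consts) :
    ¬ ∀ k : ℕ, B11Thm1.Thm1At C (MinimalActionDictionary.torusVP d L N G (k + 1)) := by
  intro hT
  -- constants
  have hB := C.B₃_pos
  set ε₁ : ℝ := min C.a₁ 1 with hε₁_def
  have hε₁ : 0 < ε₁ := lt_min C.a₁_pos one_pos
  have hε₁a : ε₁ ≤ C.a₁ := min_le_left _ _
  have hε₁1 : ε₁ ≤ 1 := min_le_right _ _
  have hM := C.Mfun_pos ε₁ hε₁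
  have hC0 := C0_pos d
  have hL1 : 1 ≤ L := by omega
  have hc2 := c2'_pos d L hL1
  have hLr : (1 : ℝ) < L := by exact_mod_cast hL
  -- the datum (hypothesis (7) at radius `ε₁`, one plaquette at distance exactly `ε₁`)
  obtain ⟨V, -, hV7, hVplaq⟩ := exists_constDatum (d := d) L N h01 hε₁.le (by linarith)
  -- the threshold for `c = 5B₃ε₁/(2L^j)` and the level
  set cmin : ℝ := min (min (1 / 4) (1 / (36 * C0 d))) (min (c2' d L / 24) (ε₁ / 48)) with hcmin_def
  have hcmin : 0 < cmin := lt_min (lt_min (by norm_num) (by positivity)) (lt_min (by positivity) (by positivity))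
  set T : ℝ := max (5 * C.B₃ * ε₁ / (2 * cmin)) (5 / (2 * C.Mfun ε₁)) with hT_def
  obtain ⟨m, hm⟩ := pow_unbounded_of_one_lt T hLr
  set Λ : ℝ := (L : ℝ) ^ (m + 1) with hΛ_def
  have hΛm : (L : ℝ) ^ m ≤ Λ := by
    rw [hΛ_def, pow_succ]; exact le_mul_of_one_le_right (by positivity) hLr.le
  have hΛT : T < Λ := hm.trans_le hΛm
  have hΛ0 : 0 < Λ := by positivity
  have hΛ1 : 1 ≤ Λ := one_le_pow₀ hLr.le
  have hT1 : 5 * C.B₃ * ε₁ / (2 * cmin) < Λ := (le_max_left _ _).trans_lt hΛT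
  have hT2 : 5 / (2 * C.Mfun ε₁) < Λ := (le_max_right _ _).trans_lt hΛT
  -- the factor `c = B₃ · cubeM · ε₁ = 5B₃ε₁/(2Λ) ≤ cmin`
  have hcube : MinimalActionDictionary.cubeM L (m + 1) 2 = 5 / (2 * Λ) := by
    rw [hΛ_def]; unfold MinimalActionDictionary.cubeM; norm_num
  set c : ℝ := C.B₃ * MinimalActionDictionary.cubeM L (m + 1) 2 * ε₁ with hc_def
  have hc_eq : c = 5 * C.B₃ * ε₁ / (2 * Λ) := by rw [hc_def, hcube]; field_simp
  have hc0 : 0 < c := by rw [hc_eq]; positivity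
  have hc_le : c ≤ cmin := by
    rw [hc_eq, div_le_iff₀ (by positivity)]
    rw [div_lt_iff₀ (by positivity)] at hT1
    nlinarith
  have hc4 : c ≤ 1 / 4 := hc_le.trans ((min_le_left _ _).trans (min_le_left _ _))
  have hcC0 : c ≤ 1 / (36 * C0 d) := hc_le.trans ((min_le_left _ _).trans (min_le_right _ _))
  have hcc2 : c ≤ c2' d L / 24 := hc_le.trans ((min_le_right _ _).trans (min_le_left _ _))
  have hcε : c ≤ ε₁ / 48 := hc_le.trans ((min_le_right _ _).trans (min_le_right _ _))
  -- Theorem 1 at level `m+1`, `ε₁`, the datum `V`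
  obtain ⟨⟨U, hU8, hUavg, hUmin⟩, -, h910⟩ := hT m ε₁ hε₁ hε₁a V hV7
  have hUcls : U ∈ sfClass d L N (C.B₃ * ε₁) (m + 1) := hU8
  have hUavg' : avgIter L U (m + 1) = V := hUavg
  obtain ⟨hUu, hUp, -⟩ := hUcls
  -- the local gauges about every site, at the `K = 2` cube
  have hgauge : ∀ x : Site d, ∃ (u : Site d → (Matrix (Fin 2) (Fin 2) ℂ)ˣ) (a : Site d → Fin d → (Matrix (Fin 2) (Fin 2) ℂ)),
      (∀ z, u z ∈ unitaryUnits (Matrix (Fin 2) (Fin 2) ℂ)) ∧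
      (∀ (y : Site d) (τ : Fin d), l1 (y - x) ≤ 2 → ((gaugeAct u U y τ : (Matrix (Fin 2) (Fin 2) ℂ)ˣ) : (Matrix (Fin 2) (Fin 2) ℂ)) = exp (a y τ)) ∧
      (∀ (y : Site d) (τ : Fin d), l1 (y - x) ≤ 2 → ‖a y τ‖ ≤ c / Λ) ∧
      (∀ (y : Site d) (τ i : Fin d), l1 (y - x) ≤ 1 → ‖fd i (fun z => a z τ) y‖ ≤ c / Λ ^ 2) := by
    intro x
    have hsizeM : (MinimalActionDictionary.torusVP d L N G (m + 1)).sizeM (x, 2) ≤ C.Mfun ε₁ := by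
      show MinimalActionDictionary.cubeM L (m + 1) 2 ≤ C.Mfun ε₁
      rw [hcube, div_le_iff₀ (by positivity)]
      rw [div_lt_iff₀ (by positivity)] at hT2
      nlinarith
    have hreg := h910 U hUmin (x, 2) hsizeM
    have hGx := MinimalActionDictionary.gauge_of_regularity hGm hL1 hreg (le_refl c)
    exact hG U x 2 _ _ _ le_rfl hGx
  -- every plaquette of `U` within `(2c + 16c²)/Λ²`
  have hsmall := smallField_of_localGauges hUu hgauge
  set r : ℝ := 2 * c + 16 * c ^ 2 with hr_def
  have hr6 : r ≤ 6 * c := by rw [hr_def]; nlinarith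
  have hr0 : 0 < r := by rw [hr_def]; positivity
  have hw : 2 * (c / Λ ^ 2) + expRem (4 * (c / Λ)) ≤ r / Λ ^ 2 := by
    have h4c0 : 0 ≤ 4 * (c / Λ) := by positivity
    have h4c1 : 4 * (c / Λ) ≤ 1 := by
      rw [mul_div_assoc']
      exact (div_le_iff₀ hΛ0).mpr (by nlinarith)
    have hρ := expRem_le_sq h4c0 h4c1
    have hid : 2 * (c / Λ ^ 2) + (4 * (c / Λ)) ^ 2 = r / Λ ^ 2 := by rw [hr_def]; field_simp; ring
    linarith
  have hUr : U ∈ sfClass d L N r (m + 1) := ⟨hUu, hUp, MinimalActionRate.SmallField.mono hsmall (by rwa [hΛ_def] at hw)⟩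
  -- Prop. 2: the datum is `4r`-small
  have hr3 : C0 d * (2 * r) ≤ 1 / 3 := by
    have : C0 d * c ≤ 1 / 36 := by
      rw [le_div_iff₀ (by positivity)] at hcC0; linarith
    nlinarith
  have hr2 : 2 * (2 * r) ≤ c2' d L := by linarith
  have hV4r := smallField_avgIter_of_mem_sfClass hL hr0 hr3 hr2 hUr hUavg'
  -- contradiction at the marked plaquette
  have key := hV4r 0 i₀ i₁ h01
  rw [hVplaq] at key
  linarith

end Refutation

/-! ## §2 At N16's objects: evidence v3∕v5's `stub_thm1At F` (the displayed N07 in-edge of the (β16) loose road) is FALSE -/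

section Stub

open Literature.MathematicalPhysics.QuantumFieldTheory.Balaban1983to89.T4Continuum (T4Family)
open Node00 (ne3NperOfRecord₁₁ MatA)
open MinimalActionDictionary (torusVP RadiiMono)
open B11Thm1 (Thm1At)

/-- **★★ `stub_thm1At F` IS FALSE FOR EVERY FAMILY `F` (gauge group rank `N = 2`).**  The statement negated below is, VERBATIM,
STUB 2 of the N16 discharge tests v3 (`N16DischargeTestL.stub_thm1At`, evidence 9292a7456083a101) and v5 (`N16DischargeTestV5.stub_thm1At`,
evidence 12c798370dcce7fe) at `N = 2`, i.e. the conjunction of the binders `hGm`∕`hG`∕`hM`∕`hT` displayed by every producer of the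
(β16) loose road (`N16H7OfReg9.leafH3sup_loose_of_thm1At_torusVP`, `N16H7LooseOfThm1At.*`, `N16InteriorOfCapture` §2–§4,
`N16PinnedLayer13CoPH` §4, `N16PinnedLooseMatch.*`, `N16LettersOfLettersB9SrcAllTorus.*_thm1At`, `N16PinnedLooseMatchOfLettersB9Src.*`):
those theorems are VACUOUS AS TYPED at `N = 2`.  The refutation does not use `hM` (`M(e) ≥ 7∕2`): the cube that breaks the
reading is the SMALL one, `K = 2`.  What is refuted is leaf-06's READING D-s3-3 of (9)–(10) (all lattice cubes, M-proportional
bound), NOT [Balaban1985Variational] Theorem 1 (cubes = unions of big blocks, `M ∈ R₁M₁ℕ`, p. 279 L1–5); the located repair is to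
read (9)–(10) on print's cube class only (N16's consumers use the single cube `K = L^{k+1} − 1 + L^{k+1} + 2`, `M ≤ 7∕2`).
[cite: Balaban1985Variational, Thm 1 (8)–(10) p.279] -/
theorem not_stub_thm1At (F : T4Family) :
    ¬ ∃ (G : (Site 4 → Fin 4 → (MatA 2)ˣ) → Site 4 → ℕ → ℝ → ℝ → ℝ → Prop) (C : B11Thm1.Consts), RadiiMono 4 G ∧
      (∀ (U : Site 4 → Fin 4 → (MatA 2)ˣ) (x : Site 4) (K : ℕ) (α₀ α₁ α₂ : ℝ), 2 ≤ K → G U x K α₀ α₁ α₂ →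
        ∃ (u : Site 4 → (MatA 2)ˣ) (a : Site 4 → Fin 4 → MatA 2),
          (∀ z, u z ∈ unitaryUnits (MatA 2)) ∧
          (∀ (y : Site 4) (τ : Fin 4), l1 (y - x) ≤ 2 → ((gaugeAct u U y τ : (MatA 2)ˣ) : MatA 2) = exp (a y τ)) ∧
          (∀ (y : Site 4) (τ : Fin 4), l1 (y - x) ≤ 2 → ‖a y τ‖ ≤ α₀) ∧
          (∀ (y : Site 4) (τ i : Fin 4), l1 (y - x) ≤ 1 → ‖fd i (fun z => a z τ) y‖ ≤ α₁) ∧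
          (∀ (τ i l : Fin 4), ‖fd i (fd l (fun z => a z τ)) x‖ ≤ α₂)) ∧
      (∀ e : ℝ, 0 < e → e ≤ C.a₁ → 7 / 2 ≤ C.Mfun e) ∧
      (∀ k : ℕ, Thm1At C (torusVP 4 F.L (ne3NperOfRecord₁₁ F 0 0) G (k + 1))) := by
  rintro ⟨G, C, hGm, hG, -, hT⟩
  have h01 : (0 : Fin 4) ≠ 1 := by decide
  have hL : 2 ≤ F.L := F.hL.2
  refine not_forall_thm1At_torusVP h01 hL (ne3NperOfRecord₁₁ F 0 0) hGm (fun U x K α₀ α₁ α₂ hK hGU => ?_) C hT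
  obtain ⟨u, a, hu, hexp, h0, h1, -⟩ := hG U x K α₀ α₁ α₂ hK hGU
  exact ⟨u, a, hu, hexp, h0, h1⟩

/-- **The same at every rank-two consumer shape with the torus factor and block size free** (`L ≥ 2`, any `Nper`): the four-binder
bundle `RadiiMono ∧ interface ∧ (M(e) ≥ 7∕2) ∧ ∀ k, Thm1At C (torusVP 4 L Nper G (k+1))` is uninhabited. [folklore] -/
theorem not_exists_thm1At_bundle {L : ℕ} (hL : 2 ≤ L) (Nper : ℕ) :
    ¬ ∃ (G : (Site 4 → Fin 4 → (MatA 2)ˣ) → Site 4 → ℕ → ℝ → ℝ → ℝ → Prop) (C : B11Thm1.Consts), RadiiMono 4 G ∧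
      (∀ (U : Site 4 → Fin 4 → (MatA 2)ˣ) (x : Site 4) (K : ℕ) (α₀ α₁ α₂ : ℝ), 2 ≤ K → G U x K α₀ α₁ α₂ →
        ∃ (u : Site 4 → (MatA 2)ˣ) (a : Site 4 → Fin 4 → MatA 2),
          (∀ z, u z ∈ unitaryUnits (MatA 2)) ∧
          (∀ (y : Site 4) (τ : Fin 4), l1 (y - x) ≤ 2 → ((gaugeAct u U y τ : (MatA 2)ˣ) : MatA 2) = exp (a y τ)) ∧
          (∀ (y : Site 4) (τ : Fin 4), l1 (y - x) ≤ 2 → ‖a y τ‖ ≤ α₀) ∧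
          (∀ (y : Site 4) (τ i : Fin 4), l1 (y - x) ≤ 1 → ‖fd i (fun z => a z τ) y‖ ≤ α₁) ∧
          (∀ (τ i l : Fin 4), ‖fd i (fd l (fun z => a z τ)) x‖ ≤ α₂)) ∧
      (∀ e : ℝ, 0 < e → e ≤ C.a₁ → 7 / 2 ≤ C.Mfun e) ∧
      (∀ k : ℕ, Thm1At C (torusVP 4 L Nper G (k + 1))) := by
  rintro ⟨G, C, hGm, hG, -, hT⟩
  have h01 : (0 : Fin 4) ≠ 1 := by decide
  refine not_forall_thm1At_torusVP h01 hL Nper hGm (fun U x K α₀ α₁ α₂ hK hGU => ?_) C hT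
  obtain ⟨u, a, hu, hexp, h0, h1, -⟩ := hG U x K α₀ α₁ α₂ hK hGU
  exact ⟨u, a, hu, hexp, h0, h1⟩

end Stub


/-! ## §3 The same for row NE3-R2's `ExpGauge` shape: the `hThm` binder of leaf-06's END over `ExpGauge` is uninhabited at rank two -/

section ExpGaugeShape

open AveragingDeficitKDatum (ExpGauge)
open MinimalActionFromThm1KDatum (radiiMono_expGauge)

/-- **`∀ k, Thm1At C (torusVP d L N (ExpGauge d) (k+1))` IS FALSE at rank two** (any `d` with two directions, `L ≥ 2`, any `N`, any `C`):
row NE3-R2's exponential-gauge shape `AveragingDeficitKDatum.ExpGauge` (a unitary gauge with `U^u = exp a` on the cube `box K y`, sup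
bounds on `a`, `∇a`, `Δa`) supplies the first-order interface of §1 at every `K ≥ 2` (the sites within `|·|₁ ≤ 2` of the centre lie in
`box 2 y ⊆ box K y`, `AveragingDeficitKDatum.mem_box_add_of_l1`), and is radii-monotone (`radiiMono_expGauge`).  Hence the hypothesis
`hThm` of leaf-06's END `MinimalActionFromThm1KDatum.upperData_of_thm1At_expGauge` ∕ `exists_tendsto_minAct_of_thm1At_expGauge` is
uninhabited for `n = Fin 2`: the same small-cube reading D-s3-3, located — not a statement about print's Theorem 1.
[cite: Balaban1985Variational, Thm 1 (8)–(10) p.279] -/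
theorem not_forall_thm1At_torusVP_expGauge {i₀ i₁ : Fin d} (h01 : i₀ ≠ i₁) {L : ℕ} (hL : 2 ≤ L) (N : ℕ) (C : B11Thm1.Consts) :
    ¬ ∀ k : ℕ, B11Thm1.Thm1At C
      (MinimalActionDictionary.torusVP d L N (ExpGauge (n := Fin 2) d) (k + 1)) := by
  refine not_forall_thm1At_torusVP h01 hL N radiiMono_expGauge (fun U x K α₀ α₁ α₂ hK hGU => ?_) C
  obtain ⟨u, a, hu, he, h0, h1, -⟩ := hGU
  have hbox : ∀ {y : Site d} {m : ℕ}, l1 (y - x) ≤ m → m ≤ K → y ∈ box K x := fun {y m} hy hm =>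
    AveragingDeficitCounting.box_mono (by omega) x
      (AveragingDeficitKDatum.mem_box_add_of_l1 (AveragingDeficitCounting.self_mem_box 0 x) hy)
  exact ⟨u, a, hu, fun y τ hy => he y τ (hbox hy hK), fun y τ hy => h0 y τ (hbox hy hK),
    fun y τ i hy => h1 y τ i (hbox hy (le_trans (by norm_num) hK))⟩

end ExpGaugeShape
end

end Summit.QuantumFields.YangMills.BalabanUVNodes.N16Thm1AtTorusVPSmallCubes
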